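import Summits.SmoothPoincare4.SmoothPoincare4.Theorems.DottedCircleRasmussenDcrTransport

/-!
# SmoothPoincare4 / DottedCircleRasmussen — engine glue `DcrEngineGlue`

Settles item stmt-SmoothPoincare4-17020 (support `DcrEngineGlue` of route DottedCircleRasmussen):
a Rasmussen certificate through the dotted circles (`DcrRasmussenWitness`) together with the GFGMW
window in the literal `S⁴` (`DcrGfgmw`) IS a one-handle slice gap (`DcrGap`).

Proof (pure logic over the route's definitions plus the proved transport support
`Theorems.DcrTransport_proof`): take the witness `(k, K₀, Σ, e, f, w)` with `0 < s₋` or `s₊ < 0`;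
`MMSW.IsModelKnot` and `MMSW.IsSliceDiscInComplement` are by definition (`Iff.rfl`) the literal
binder block and slice datum of `DcrGap`; for the no-disc clause, a datum `(e', f')` in some `N`
with `Φ : N ≃ₘ S⁴` transports to `(Φ ∘ e', Φ ∘ f')` in the literal `S⁴` (`DcrTransport_proof`), where
`DcrGfgmw` gives `s₋(K₀) ≤ 0 ≤ s₊(K₀)` for `w` — a contradiction. [folklore]
-/

-- the registered namespace `Summit.SmoothPoincare4.SmoothPoincare4.Theorems` repeats a component
set_option linter.dupNamespace false

namespace Summit.SmoothPoincare4.SmoothPoincare4.Theorems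

open scoped Manifold ContDiff
open Summit.SmoothPoincare4.SmoothPoincare4.Theses.DottedCircleRasmussen
open Literature.Topology.FourManifolds

/-- Settles stmt-SmoothPoincare4-17020: the engine glue `DcrEngineGlue` of route
DottedCircleRasmussen — `DcrRasmussenWitness → DcrGfgmw → DcrGap`. The witness supplies `k`, the
model knot `K₀` (= the literal binder block of `DcrGap`, `MMSW.isModelKnot_iff`), the homotopy
sphere with its slice datum (= the literal datum, `MMSW.isSliceDiscInComplement_iff`) and invariants
`w` outside the window; a datum in any `N ≅ S⁴` is transported to the literal `S⁴` by
`DcrTransport_proof`, where `DcrGfgmw` puts `w` inside the window `s₋ ≤ 0 ≤ s₊`. [folklore] -/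
theorem DcrEngineGlue_proof :
    Summit.SmoothPoincare4.SmoothPoincare4.Theses.DottedCircleRasmussen.DcrEngineGlue := by
  unfold DcrEngineGlue DcrRasmussenWitness DcrGfgmw DcrGap
  intro hW hG
  obtain ⟨k, -, K, hK, -, ⟨M, i1, i2, i3, i4, i5, hh, e, f, hf⟩, w, hw⟩ := hW
  refine ⟨k, K, (MMSW.isModelKnot_iff K).1 hK,
    ⟨M, i1, i2, i3, i4, i5, hh, e, f, (MMSW.isSliceDiscInComplement_iff K M e f).1 hf⟩, ?_⟩
  intro N _ _ _ _ _ hN e' f' hf'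
  obtain ⟨Φ⟩ := hN
  have hT := DcrTransport_proof N Φ k e' K f' hf'
  have hwin := hG k K (Φ ∘ e') (Φ ∘ f')
    ((MMSW.isSliceDiscInComplement_iff K _ (Φ ∘ e') (Φ ∘ f')).2 hT) w
  omega

end Summit.SmoothPoincare4.SmoothPoincare4.Theorems
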